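import Mathlib.Algebra.Polynomial.Splits
import Mathlib.RingTheory.Valuation.Basic
import HarnessLib

/-!
# The valuation of `g(ρ)` against `g'(ρ)` for a split polynomial with good reduction

Let `K` be a field with a valuation `v : K → Γ₀` and `g ∈ K[X]` a polynomial that splits in `K`,
with `v`-unit leading coefficient, `v`-integral roots which are pairwise distinct modulo the maximal
ideal of `v` (`v (a - a') = 1` for distinct roots `a ≠ a'`) and whose root multiplicities are
`v`-units ("tame": `v m = 1`). Then for every `v`-integral `ρ` with `0 < v (g ρ) < 1` there is a
root `a₀` close to `ρ` (`v (ρ - a₀) < 1`; it is unique), and, `m₀` denoting its multiplicity,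

  `v (g ρ) = v (ρ - a₀) ^ m₀`,  `v (g' ρ) = v (ρ - a₀) ^ (m₀ - 1)`,  so  `v (g ρ) = v (ρ - a₀) · v (g' ρ) < v (g' ρ)`;

in additive language `ord (g ρ) - ord (g' ρ) = ord (ρ - a₀) ≥ 1`.
This is the one-variable engine of the "sharp" conductor-versus-height inequality ([GenEll] Prop. 1.6
for a REDUCED divisor) on an explicit cover of `ℙ¹`: at a prime of good reduction a point meeting a
fibre `t = b` does so with intersection multiplicity exceeding its intersection multiplicity with the
ramification divisor by at least one (S. Mochizuki, *Arithmetic elliptic curves in general position*,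
Math. J. Okayama Univ. 52 (2010), Prop. 1.6 p. 10 "(Conductor Bounded by the Height)" and the
proof of Thm. 2.1 pp. 12–13 [cite: MochizukiGenEll2010, Prop 1.6 p.10]; the tags below cite the printed
statement this file serves — the lemma itself is elementary ultrametric algebra).

Also recorded, for the consumers: integral coefficients and `v x ≤ 1` give `v (p x) ≤ 1`; for
`1 < v x` and unit leading coefficient `v (p x) = (v x) ^ deg p` (so roots are integral); integrality
of coefficients is stable under products and derivatives.

Mathlib-only, theorems only. abc-iut cell support file for route item stmt-ABC-19679 (`GenEllTwo`,
package W4b/W5 of the GENELLTWO-P1ROUTE note, seat abc-iut-w5-d045); classical and undisputed,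
nothing here bears on [IUTchIII] Cor. 3.12.
-/

namespace Literature.NumberTheory.DiophantineGeometry.GenEll

open _root_.Polynomial

variable {K : Type*} [Field K] {Γ₀ : Type*} [LinearOrderedCommGroupWithZero Γ₀]
  (v : Valuation K Γ₀)

/-! ## Integral coefficients -/

/-- A polynomial with `v`-integral coefficients takes `v`-integral values at `v`-integral arguments.
[cite: MochizukiGenEll2010, Prop 1.6 p.10] -/
theorem valuation_eval_le_one {p : K[X]} (hp : ∀ n, v (p.coeff n) ≤ 1) {x : K} (hx : v x ≤ 1) :
    v (p.eval x) ≤ 1 := by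
  rw [eval_eq_sum_range]
  exact v.map_sum_le fun i _ => by
    rw [map_mul, map_pow]
    exact mul_le_one' (hp i) (pow_le_one' hx _)

/-- If `1 < v x`, the coefficients of `p` are `v`-integral and its leading coefficient is a `v`-unit,
then the top term dominates: `v (p x) = (v x) ^ deg p`. [cite: MochizukiGenEll2010, Prop 1.6 p.10] -/
theorem valuation_eval_eq_pow_of_one_lt {p : K[X]} (hp : ∀ n, v (p.coeff n) ≤ 1)
    (hlc : v p.leadingCoeff = 1) {x : K} (hx : 1 < v x) :
    v (p.eval x) = v x ^ p.natDegree := by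
  have hx0 : v x ≠ 0 := ne_of_gt (lt_trans zero_lt_one hx)
  rw [eval_eq_sum_range, Finset.sum_range_succ, coeff_natDegree, v.map_add_eq_of_lt_right]
  · rw [map_mul, map_pow, hlc, one_mul]
  · rw [map_mul, map_pow, hlc, one_mul]
    refine v.map_sum_lt (pow_ne_zero _ hx0) fun i hi => ?_
    rw [Finset.mem_range] at hi
    rw [map_mul, map_pow]
    calc v (p.coeff i) * v x ^ i ≤ v x ^ i := mul_le_of_le_one_left' (hp i)
      _ < v x ^ p.natDegree := pow_lt_pow_right₀ hx hi

/-- A root of a polynomial with `v`-integral coefficients and `v`-unit leading coefficient is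
`v`-integral. [cite: MochizukiGenEll2010, Prop 1.6 p.10] -/
theorem valuation_le_one_of_isRoot {p : K[X]} (hp : ∀ n, v (p.coeff n) ≤ 1)
    (hlc : v p.leadingCoeff = 1) {a : K} (ha : p.IsRoot a) : v a ≤ 1 := by
  by_contra h
  push Not at h
  have h1 := valuation_eval_eq_pow_of_one_lt v hp hlc h
  rw [show p.eval a = 0 from ha, map_zero] at h1
  exact pow_ne_zero _ (ne_of_gt (lt_trans zero_lt_one h)) h1.symm

/-- Integrality of coefficients is preserved by products. [cite: MochizukiGenEll2010, Prop 1.6 p.10] -/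
theorem valuation_coeff_mul_le_one {p q : K[X]} (hp : ∀ n, v (p.coeff n) ≤ 1)
    (hq : ∀ n, v (q.coeff n) ≤ 1) (n : ℕ) : v ((p * q).coeff n) ≤ 1 := by
  rw [coeff_mul]
  exact v.map_sum_le fun i _ => by
    rw [map_mul]
    exact mul_le_one' (hp _) (hq _)

/-- Integrality of coefficients is preserved by derivatives. [cite: MochizukiGenEll2010, Prop 1.6 p.10] -/
theorem valuation_coeff_derivative_le_one {p : K[X]} (hp : ∀ n, v (p.coeff n) ≤ 1) (n : ℕ) :
    v ((derivative p).coeff n) ≤ 1 := by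
  rw [coeff_derivative, map_mul]
  -- `v (n + 1) ≤ 1` (ultrametric inequality; cf. the tree's
  -- `Literature.NumberTheory.LFunctions.valuation_natCast_le_one`, not imported to keep this file light)
  have h : ∀ m : ℕ, v (m : K) ≤ 1 := fun m => by
    induction m with
    | zero => simp
    | succ m ih =>
      rw [Nat.cast_succ]
      exact (v.map_add _ _).trans (max_le ih (le_of_eq v.map_one))
  have h1 : v ((n : K) + 1) ≤ 1 := by simpa [Nat.cast_succ] using h (n + 1)
  exact mul_le_one' (hp _) h1

/-- The coefficients of `X - C a` are `v`-integral when `a` is. [cite: MochizukiGenEll2010, Prop 1.6 p.10] -/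
theorem valuation_coeff_X_sub_C_le_one {a : K} (ha : v a ≤ 1) (n : ℕ) :
    v ((X - C a : K[X]).coeff n) ≤ 1 := by
  rcases n with _ | _ | n
  · simpa using ha
  · simp
  · simp [coeff_X]

/-- The coefficients of `∏ (X - C a)` over a multiset of `v`-integral `a` are `v`-integral. [cite: MochizukiGenEll2010, Prop 1.6 p.10] -/
theorem valuation_coeff_multiset_prod_X_sub_C_le_one {s : Multiset K} (hs : ∀ a ∈ s, v a ≤ 1)
    (n : ℕ) : v ((s.map (X - C ·)).prod.coeff n) ≤ 1 := by
  induction s using Multiset.induction_on generalizing n with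
  | empty =>
    rw [Multiset.map_zero, Multiset.prod_zero, coeff_one]
    split_ifs <;> simp
  | cons a s ih =>
    rw [Multiset.map_cons, Multiset.prod_cons]
    exact valuation_coeff_mul_le_one v
      (valuation_coeff_X_sub_C_le_one v (hs a (Multiset.mem_cons_self a s)))
      (fun m => ih (fun b hb => hs b (Multiset.mem_cons_of_mem hb)) m) n

/-! ## Closeness to a unique root -/

/-- If `ρ` is close to `a` (`v (ρ - a) < 1`) and `a`, `b` are distinct modulo `v` (`v (a - b) = 1`),
then `v (ρ - b) = 1`. [cite: MochizukiGenEll2010, Prop 1.6 p.10] -/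
theorem valuation_sub_eq_one_of_lt {ρ a b : K} (h1 : v (ρ - a) < 1) (h2 : v (a - b) = 1) :
    v (ρ - b) = 1 := by
  have : ρ - b = (a - b) + (ρ - a) := by ring
  rw [this, v.map_add_eq_of_lt_left (by rwa [h2]), h2]

/-- For a split polynomial `g` with `v`-unit leading coefficient and `v`-integral roots, an integral
`ρ` with `v (g ρ) < 1` is close to some root: `v (ρ - a₀) < 1`. [cite: MochizukiGenEll2010, Prop 1.6 p.10] -/
theorem exists_root_valuation_sub_lt_one {g : K[X]} (hs : g.Splits) (hlc : v g.leadingCoeff = 1)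
    (hint : ∀ a ∈ g.roots, v a ≤ 1) {ρ : K} (hρ : v ρ ≤ 1) (hlt : v (g.eval ρ) < 1) :
    ∃ a ∈ g.roots, v (ρ - a) < 1 := by
  by_contra h
  push Not at h
  have hprod : ((g.roots.map (ρ - ·)).map v).prod = 1 :=
    Multiset.prod_eq_one fun x hx => by
      obtain ⟨y, hy, rfl⟩ := Multiset.mem_map.1 hx
      obtain ⟨a, ha, rfl⟩ := Multiset.mem_map.1 hy
      exact le_antisymm (v.map_sub_le hρ (hint a ha)) (h a ha)
  have h1 : v (g.eval ρ) = 1 := by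
    rw [hs.eval_eq_prod_roots, map_mul, hlc, one_mul, map_multiset_prod, hprod]
  rw [h1] at hlt
  exact lt_irrefl _ hlt

/-- The close root is unique: two roots close to `ρ` coincide (roots distinct modulo `v`). [cite: MochizukiGenEll2010, Prop 1.6 p.10] -/
theorem root_eq_of_valuation_sub_lt_one {g : K[X]}
    (hsep : ∀ a ∈ g.roots, ∀ a' ∈ g.roots, a ≠ a' → v (a - a') = 1)
    {ρ a a' : K} (ha : a ∈ g.roots) (ha' : a' ∈ g.roots) (h1 : v (ρ - a) < 1)
    (h2 : v (ρ - a') < 1) : a = a' := by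
  by_contra hne
  have := valuation_sub_eq_one_of_lt v h1 (hsep a ha a' ha' hne)
  rw [this] at h2
  exact lt_irrefl _ h2

/-! ## The multiplicity gap -/

/-- **Valuation of `g(ρ)` versus `g'(ρ)`** (good reduction). Let `g` split in `K` with `v`-unit leading
coefficient, `v`-integral roots pairwise distinct modulo `v`, and root multiplicities that are
`v`-units. If `ρ` is `v`-integral with `g ρ ≠ 0` and `v (g ρ) < 1`, then for the (unique) root `a₀`
with `v (ρ - a₀) < 1`, of multiplicity `m₀ ≥ 1`: `v (g ρ) = v (ρ - a₀) ^ m₀` and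
`v (g' ρ) = v (ρ - a₀) ^ (m₀ - 1)`. [cite: MochizukiGenEll2010, Prop 1.6 p.10] -/
theorem exists_root_valuation_eval_eq {g : K[X]} (hs : g.Splits) (hlc : v g.leadingCoeff = 1)
    (hint : ∀ a ∈ g.roots, v a ≤ 1)
    (hsep : ∀ a ∈ g.roots, ∀ a' ∈ g.roots, a ≠ a' → v (a - a') = 1)
    (htame : ∀ a ∈ g.roots, v (g.rootMultiplicity a : K) = 1)
    {ρ : K} (hρ : v ρ ≤ 1) (hg : g.eval ρ ≠ 0) (hlt : v (g.eval ρ) < 1) :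
    ∃ a ∈ g.roots, v (ρ - a) < 1 ∧ 0 < g.rootMultiplicity a ∧
      v (g.eval ρ) = v (ρ - a) ^ g.rootMultiplicity a ∧
      v ((derivative g).eval ρ) = v (ρ - a) ^ (g.rootMultiplicity a - 1) := by
  classical
  have hg0 : g ≠ 0 := by rintro rfl; exact hg eval_zero
  obtain ⟨a, ha, hva⟩ := exists_root_valuation_sub_lt_one v hs hlc hint hρ hlt
  have hρa0 : v (ρ - a) ≠ 0 := by
    intro h0
    rw [v.zero_iff, sub_eq_zero] at h0
    rw [h0] at hg
    exact hg ((mem_roots hg0).1 ha)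
  have hmpos : 0 < g.rootMultiplicity a := (rootMultiplicity_pos hg0).2 ((mem_roots hg0).1 ha)
  -- the factorisation `g = (X - a)^m * h`
  obtain ⟨q, hq⟩ : ∃ q : K[X], q = (X - C a) ^ g.rootMultiplicity a := ⟨_, rfl⟩
  obtain ⟨h, hh⟩ : ∃ h : K[X], h = g /ₘ q := ⟨_, rfl⟩
  have hqh : q * h = g := by
    rw [hh, hq]; exact pow_mul_divByMonic_rootMultiplicity_eq g a
  have hqmonic : q.Monic := by rw [hq]; exact (monic_X_sub_C a).pow _
  have hqh0 : q * h ≠ 0 := by rw [hqh]; exact hg0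
  have hh0 : h ≠ 0 := fun h0 => hqh0 (by rw [h0, mul_zero])
  -- roots of `h`: among the roots of `g`, and different from `a`
  have hha : h.eval a ≠ 0 := by
    rw [hh, hq]; exact eval_divByMonic_pow_rootMultiplicity_ne_zero a hg0
  have hroots : ∀ b ∈ h.roots, b ∈ g.roots ∧ b ≠ a := by
    intro b hb
    refine ⟨?_, ?_⟩
    · rw [← hqh, roots_mul hqh0]
      exact Multiset.mem_add.2 (Or.inr hb)
    · rintro rfl
      exact hha ((mem_roots hh0).1 hb)
  have hhs : h.Splits := hs.of_dvd hg0 ⟨q, by rw [mul_comm, hqh]⟩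
  have hhlc : v h.leadingCoeff = 1 := by
    have h1 : g.leadingCoeff = q.leadingCoeff * h.leadingCoeff := by
      rw [← hqh, leadingCoeff_mul]
    rw [hqmonic.leadingCoeff, one_mul] at h1
    rw [← h1, hlc]
  -- `v (h ρ) = 1`
  have hvh : v (h.eval ρ) = 1 := by
    rw [hhs.eval_eq_prod_roots, map_mul, hhlc, one_mul, map_multiset_prod]
    refine Multiset.prod_eq_one fun x hx => ?_
    obtain ⟨y, hy, rfl⟩ := Multiset.mem_map.1 hx
    obtain ⟨b, hb, rfl⟩ := Multiset.mem_map.1 hy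
    obtain ⟨hbg, hba⟩ := hroots b hb
    exact valuation_sub_eq_one_of_lt v hva (hsep a ha b hbg (Ne.symm hba))
  -- `v (h' ρ) ≤ 1`
  have hvh' : v ((derivative h).eval ρ) ≤ 1 := by
    refine valuation_eval_le_one v (valuation_coeff_derivative_le_one v (fun n => ?_)) hρ
    have hint' : ∀ b ∈ h.roots, v b ≤ 1 := fun b hb => hint b (hroots b hb).1
    rw [hhs.eq_prod_roots, coeff_C_mul, map_mul, hhlc, one_mul]
    exact valuation_coeff_multiset_prod_X_sub_C_le_one v hint' n
  -- values of `g` and `g'` at `ρ`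
  have hq_eval : q.eval ρ = (ρ - a) ^ g.rootMultiplicity a := by
    rw [hq, eval_pow, eval_sub, eval_X, eval_C]
  have hg_eval : g.eval ρ = (ρ - a) ^ g.rootMultiplicity a * h.eval ρ := by
    rw [show g.eval ρ = (q * h).eval ρ by rw [hqh], eval_mul, hq_eval]
  have hg'_eval : (derivative g).eval ρ =
      (g.rootMultiplicity a : K) * (ρ - a) ^ (g.rootMultiplicity a - 1) * h.eval ρ +
        (ρ - a) ^ g.rootMultiplicity a * (derivative h).eval ρ := by
    rw [show (derivative g).eval ρ = (derivative (q * h)).eval ρ by rw [hqh], derivative_mul,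
      eval_add, eval_mul, eval_mul, hq_eval, hq, derivative_X_sub_C_pow, eval_mul, eval_C,
      eval_pow, eval_sub, eval_X, eval_C]
  refine ⟨a, ha, hva, hmpos, ?_, ?_⟩
  · rw [hg_eval, map_mul, map_pow, hvh, mul_one]
  · rw [hg'_eval, v.map_add_eq_of_lt_left]
    · simp only [map_mul, map_pow, htame a ha, hvh, one_mul, mul_one]
    · simp only [map_mul, map_pow, htame a ha, hvh, one_mul, mul_one]
      calc v (ρ - a) ^ g.rootMultiplicity a * v ((derivative h).eval ρ)
          ≤ v (ρ - a) ^ g.rootMultiplicity a := mul_le_of_le_one_right' hvh'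
        _ = v (ρ - a) * v (ρ - a) ^ (g.rootMultiplicity a - 1) := by
          rw [← pow_succ', Nat.sub_add_cancel hmpos]
        _ < 1 * v (ρ - a) ^ (g.rootMultiplicity a - 1) :=
          mul_lt_mul_of_pos_right hva (zero_lt_iff.2 (pow_ne_zero _ hρa0))
        _ = v (ρ - a) ^ (g.rootMultiplicity a - 1) := one_mul _

/-- **The multiplicity gap.** Under the hypotheses of `exists_root_valuation_eval_eq`:
`v (g ρ) = v (ρ - a₀) · v (g' ρ)` for a root `a₀` with `v (ρ - a₀) < 1`; in particular `g' ρ ≠ 0` and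
`v (g ρ) < v (g' ρ)`, i.e. `ord (g ρ) ≥ ord (g' ρ) + 1` for a discrete valuation. [cite: MochizukiGenEll2010, Prop 1.6 p.10] -/
theorem exists_root_valuation_eval_eq_mul_derivative {g : K[X]} (hs : g.Splits)
    (hlc : v g.leadingCoeff = 1) (hint : ∀ a ∈ g.roots, v a ≤ 1)
    (hsep : ∀ a ∈ g.roots, ∀ a' ∈ g.roots, a ≠ a' → v (a - a') = 1)
    (htame : ∀ a ∈ g.roots, v (g.rootMultiplicity a : K) = 1)
    {ρ : K} (hρ : v ρ ≤ 1) (hg : g.eval ρ ≠ 0) (hlt : v (g.eval ρ) < 1) :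
    ∃ a ∈ g.roots, v (ρ - a) < 1 ∧
      v (g.eval ρ) = v (ρ - a) * v ((derivative g).eval ρ) := by
  obtain ⟨a, ha, hva, hmpos, h1, h2⟩ :=
    exists_root_valuation_eval_eq v hs hlc hint hsep htame hρ hg hlt
  refine ⟨a, ha, hva, ?_⟩
  rw [h1, h2, ← pow_succ', Nat.sub_add_cancel hmpos]

/-- **The multiplicity gap, inequality form**: under the hypotheses of
`exists_root_valuation_eval_eq`, `v (g ρ) < v (g' ρ)` (so `ord_v (g ρ) ≥ ord_v (g' ρ) + 1` when `v`
is discrete) and `g' ρ ≠ 0`. [cite: MochizukiGenEll2010, Prop 1.6 p.10] -/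
theorem valuation_eval_lt_valuation_eval_derivative {g : K[X]} (hs : g.Splits)
    (hlc : v g.leadingCoeff = 1) (hint : ∀ a ∈ g.roots, v a ≤ 1)
    (hsep : ∀ a ∈ g.roots, ∀ a' ∈ g.roots, a ≠ a' → v (a - a') = 1)
    (htame : ∀ a ∈ g.roots, v (g.rootMultiplicity a : K) = 1)
    {ρ : K} (hρ : v ρ ≤ 1) (hg : g.eval ρ ≠ 0) (hlt : v (g.eval ρ) < 1) :
    (derivative g).eval ρ ≠ 0 ∧ v (g.eval ρ) < v ((derivative g).eval ρ) := by
  obtain ⟨a, -, hva, h⟩ :=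
    exists_root_valuation_eval_eq_mul_derivative v hs hlc hint hsep htame hρ hg hlt
  have hd0 : v ((derivative g).eval ρ) ≠ 0 := by
    intro h0
    rw [h0, mul_zero, v.zero_iff] at h
    exact hg h
  refine ⟨(v.ne_zero_iff).1 hd0, ?_⟩
  calc v (g.eval ρ) = v (ρ - a) * v ((derivative g).eval ρ) := h
    _ < 1 * v ((derivative g).eval ρ) := mul_lt_mul_of_pos_right hva (zero_lt_iff.2 hd0)
    _ = v ((derivative g).eval ρ) := one_mul _

end Literature.NumberTheory.DiophantineGeometry.GenEll
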